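import Mathlib.Analysis.Complex.Schwarz
import Mathlib.Analysis.Complex.HasPrimitives
import Mathlib.Analysis.Calculus.Deriv.Star
import Literature.Probability.RandomPlanarGeometry.RestrictionHulls
import HarnessLib

/-!
# `Φ'_A(0)` exists and lies in `(0, 1]`: proof of [LSW] (2.4)

This file discharges the named fact `Literature.Probability.RandomPlanarGeometry.IsStarHull.exists_hasRestrictionDeriv` of
`Literature.Probability.RandomPlanarGeometry.RestrictionHulls`:

* G. F. Lawler, O. Schramm, W. Werner, *Conformal restriction: the chordal case*, J. Amer. Math.
  Soc. **16** (2003) 917–955, arXiv:math/0209343 (**[LSW]**), §2, (2.4) p. 7: "Since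
  `Im g_A(z) − Im z` is harmonic, bounded, and has non-positive boundary values,
  `Im g_A(z) ≤ Im z`. Consequently, `0 < g_A'(x) ≤ 1`, `x ∈ ℝ ∖ A`."

applied at `x = 0 ∉ A` to `Φ_A = g_A − g_A(0)` (so `Φ_A' = g_A'`): for a `*`-hull `A` and any
restriction map `Φ` of `A` (`Literature.Probability.RandomPlanarGeometry.IsRestrictionMap`: a conformal equivalence `ℍₒ ∖ A → ℍₒ` with
boundary value `0` at `0` and `Φ(z)/z → 1` at `∞`) the limit `d = lim_{z → 0} Φ(z)/z` within
`ℍₒ ∖ A` exists (`Literature.HasRestrictionDeriv A Φ d`) and `0 < d ≤ 1`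
(`Literature.Probability.RandomPlanarGeometry.IsStarHull.exists_hasRestrictionDeriv_holds`).

## Proof

The printed proof has two steps, `Im Φ ≤ Im z` and the passage to the boundary derivative (where
[LSW] use, implicitly here and explicitly in the proof of Lemma 3.5, that "the maps may be extended
to a neighborhood of `0` by Schwarz reflection in the real line"). We prove both, replacing the
maximum principle for harmonic functions (not available) by Schwarz–Pick arguments:

1. `Literature.Probability.RandomPlanarGeometry.HalfPlanePick.norm_sub_sq_mul_le` — the **Schwarz–Pick lemma in `ℍₒ`** (two-point,
   invariant form `|F a − F b|²/(Im F a · Im F b) ≤ |a − b|²/(Im a · Im b)` for a holomorphic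
   self-map `F` of `ℍₒ`), from Mathlib's Schwarz lemma `Complex.norm_le_norm_of_mapsTo_ball`
   through the Möbius maps `T_b(w) = (w − b)/(w − b̄)` and their inverses
   `S_b(ζ) = (b − b̄ζ)/(1 − ζ)` (both written out explicitly, no auxiliary definitions);
   and `HalfPlanePick.norm_deriv_le_two_mul_im_div` — `|f'(c)| ≤ 2 Im f(c)/R` for `f` holomorphic
   on `B(c, R)` with values in `ℍₒ` (`Complex.norm_deriv_le_div_of_mapsTo_ball`).
2. `Literature.Probability.RandomPlanarGeometry.IsRestrictionMap.im_le_im` — **`Im Φ(z) ≤ Im z`** on `ℍₒ ∖ A` (Julia's lemma at `∞`):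
   Schwarz–Pick for `Φ⁻¹ : ℍₒ → ℍₒ ∖ A ⊆ ℍₒ` at the pair `(Φ z, Φ(iy))`, divided by `y³`, tends
   to `Im Φ(z) ≤ Im z` as `y → ∞` because `Φ(iy)/(iy) → 1`. (The tree's
   `Complex.im_le_im_of_tendsto_sub_self`, `Literature.Analysis.Complex.HalfPlaneRigidity`, is the
   same inequality under the stronger normalisation `g(z) − z → 0`, by the maximum principle; the
   hypothesis `Φ(z)/z → 1` of `IsRestrictionMap` needs the argument given here.)
3. `Literature.Probability.RandomPlanarGeometry.IsRestrictionMap.norm_deriv_le_two`, `.lipschitzOnWith`, `.exists_extension`,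
   `.extension_ofReal_im`, `.extension_zero` — on a half-disc `W = ℍₒ ∩ B(0, r)` with
   `B(0, 2r) ∩ A = ∅`: `|Φ'| ≤ 2 Im Φ/Im z ≤ 2`, so `Φ` is `2`-Lipschitz on the convex set `W`
   (`Convex.lipschitzOnWith_of_nnnorm_deriv_le`) and extends to a continuous `G`
   (`LipschitzOnWith.extend_finite_dimension`), real on `(−r, r)` (as `0 < Im Φ(z) ≤ Im z → 0`)
   and with `G(0) = 0` (the hypothesis `Φ(0) = 0`).
4. `Literature.Probability.RandomPlanarGeometry.SchwarzReflection.differentiableOn_reflect` — the **Schwarz reflection principle** for a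
   function continuous up to the real segment with real values there: the reflected function is
   continuous on `B(0, r)` and holomorphic off the real line, hence holomorphic, by **Morera's
   theorem across a line** (`SchwarzReflection.differentiableOn_of_off_real`: split rectangles
   at height `0`, Cauchy–Goursat on the halves, Mathlib's
   `Complex.isConservativeOn_and_continuousOn_iff_isDifferentiableOn`; the same argument as
   `Literature.Analysis.FunctionSpaces.differentiableOn_of_continuousOn_of_differentiableOn_off_im_eq` in
   `Literature.Analysis.FunctionSpaces.KMSStates`, repeated here to keep the imports light).
5. With `F` the reflection of `G` and `c = F'(0)`: `Φ(z)/z = F(z)/z → c` within `ℍₒ ∖ A`; `c` is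
   real (approach along the real axis, where `F = G` is real); `0 ≤ c ≤ 1` (approach along
   `z = it`: `Re (Φ(it)/(it)) = Im Φ(it)/t ∈ (0, 1]`); and `c ≠ 0` by
   `Literature.Probability.RandomPlanarGeometry.SchwarzReflection.deriv_ne_zero_of_im_pos`: if `F'(0) = 0` then `F(z) = zⁿ g(z)` near `0`
   with `n ≥ 2`, `g(0) ≠ 0` (`AnalyticAt.exists_eventuallyEq_pow_smul_nonzero_iff`), and for a
   direction `ω ∈ ℍₒ` with `Im (ωⁿ g(0)) < 0` (`exists_im_pow_mul_neg`) the points `tω ∈ W`,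
   `t ↓ 0`, would have `Im F(tω) < 0`, contradicting `Im Φ > 0`.

Everything in this file is proved; no named fact is used.

## Mathlib

We USE `Complex.norm_le_norm_of_mapsTo_ball`, `Complex.norm_deriv_le_div_of_mapsTo_ball`
(Schwarz), `Convex.lipschitzOnWith_of_nnnorm_deriv_le`, `LipschitzOnWith.extend_finite_dimension`,
`Complex.isConservativeOn_and_continuousOn_iff_isDifferentiableOn` (Morera),
`Complex.integral_boundary_rect_eq_zero_of_continuousOn_of_differentiableOn` (Cauchy–Goursat),
`DifferentiableAt.conj_conj`, `DifferentiableOn.analyticAt`,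
`AnalyticAt.exists_eventuallyEq_pow_smul_nonzero_iff`, `hasDerivAt_iff_tendsto_slope`,
`ContinuousOn.if`, `Complex.frontier_setOf_le_im`. Mathlib has no Schwarz–Pick lemma for the
half-plane and no Schwarz reflection principle (searched `Pick`, `reflection`).

## References

* G. F. Lawler, O. Schramm, W. Werner, *Conformal restriction: the chordal case*, J. Amer. Math.
  Soc. **16** (2003), §2 (2.4), p. 7; proof of Lemma 3.5 (Schwarz reflection of `Φ_A`).
* L. V. Ahlfors, *Complex Analysis*, McGraw-Hill (2nd ed. 1966 / 3rd ed. 1979), Ch. 4 §3.4: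
  Thm. 13 (the lemma of Schwarz), its invariant form (34), Exercise 3 (the half-plane form).
* J. B. Conway, *Functions of One Complex Variable*, Springer GTM 11 (1973; 2nd ed. 1978), Ch. IX
  Thm. 1.1 (Schwarz Reflection Principle, via Morera's theorem).
* Ch. Pommerenke, *Boundary Behaviour of Conformal Maps*, Springer (1992), §4.3 (Julia's lemma).
-/

noncomputable section

open Set Filter Topology Metric Complex
open UpperHalfPlane (upperHalfPlaneSet isOpen_upperHalfPlaneSet)
open scoped ComplexConjugate

namespace Literature.Probability.RandomPlanarGeometry

namespace HalfPlanePick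

/-!
The Möbius map `T_b(w) = (w - b)/(w - b̄)` carries `ℍₒ` onto the unit disc with `b ↦ 0` (for
`b ∈ ℍₒ`); its inverse is `S_b(ζ) = (b - b̄ ζ)/(1 - ζ)`. Both are written out explicitly below
(no auxiliary definitions), `T_b(w)` as `(w - b) / (w - conj b)` and `S_b(ζ)` as
`(b - conj b * ζ) / (1 - ζ)`.
-/

/-- `w - b̄ ≠ 0` for `b ∈ ℍₒ`, `im w ≥ 0`. [folklore] -/
theorem sub_conj_ne_zero {b w : ℂ} (hb : 0 < b.im) (hw : 0 ≤ w.im) : w - conj b ≠ 0 := by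
  intro h
  have := congrArg Complex.im h
  simp only [sub_im, conj_im, zero_im] at this
  linarith

/-- `b - b̄ ≠ 0` for `im b ≠ 0`. [folklore] -/
theorem self_sub_conj_ne_zero {b : ℂ} (hb : b.im ≠ 0) : b - conj b ≠ 0 := by
  intro h
  have := congrArg Complex.im h
  simp only [sub_im, conj_im, zero_im] at this
  exact hb (by linarith)

/-- `|w - b̄|² = |w - b|² + 4 im w im b`. [folklore] -/
theorem norm_sub_conj_sq (b w : ℂ) : ‖w - conj b‖ ^ 2 = ‖w - b‖ ^ 2 + 4 * w.im * b.im := by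
  rw [← normSq_eq_norm_sq, ← normSq_eq_norm_sq]
  simp only [normSq_apply, sub_re, conj_re, sub_im, conj_im]
  ring

/-- `T_b` maps `ℍₒ` into the unit disc (`b ∈ ℍₒ`): `|(w - b)/(w - b̄)| < 1`. [folklore] -/
theorem norm_moebius_lt_one {b w : ℂ} (hb : 0 < b.im) (hw : 0 < w.im) :
    ‖(w - b) / (w - conj b)‖ < 1 := by
  rw [norm_div, div_lt_one (norm_pos_iff.2 (sub_conj_ne_zero hb hw.le))]
  refine lt_of_pow_lt_pow_left₀ 2 (norm_nonneg _) ?_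
  rw [norm_sub_conj_sq]
  nlinarith [mul_pos hw hb]

/-- `S_b (T_b w) = w`. [folklore] -/
theorem moebiusInv_moebius {b w : ℂ} (hb : b.im ≠ 0) (hw : w - conj b ≠ 0) :
    (b - conj b * ((w - b) / (w - conj b))) / (1 - (w - b) / (w - conj b)) = w := by
  have hbb := self_sub_conj_ne_zero hb
  have h1 : (1 : ℂ) - (w - b) / (w - conj b) = (b - conj b) / (w - conj b) := by
    field_simp
    ring
  rw [h1, div_div_eq_mul_div]
  field_simp
  ring

/-- `im S_b(ζ) = im b (1 - |ζ|²)/|1 - ζ|²`. [folklore] -/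
theorem moebiusInv_im (b ζ : ℂ) :
    ((b - conj b * ζ) / (1 - ζ)).im = b.im * (1 - normSq ζ) / normSq (1 - ζ) := by
  rw [div_im]
  simp only [sub_im, mul_im, conj_re, conj_im, sub_re, mul_re, one_re, one_im, normSq_apply]
  ring

/-- `S_b` maps the unit disc into `ℍₒ` (`b ∈ ℍₒ`). [folklore] -/
theorem moebiusInv_im_pos {b ζ : ℂ} (hb : 0 < b.im) (hζ : ‖ζ‖ < 1) :
    0 < ((b - conj b * ζ) / (1 - ζ)).im := by
  have hζ1 : ζ ≠ 1 := by
    rintro rfl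
    simp at hζ
  have hn : normSq ζ < 1 := by
    rw [normSq_eq_norm_sq]
    nlinarith [norm_nonneg ζ]
  rw [moebiusInv_im]
  exact div_pos (mul_pos hb (by linarith)) (normSq_pos.2 (sub_ne_zero.2 (Ne.symm hζ1)))

/-- `T_p` is holomorphic on `ℍₒ` for `p ∈ ℍₒ`. [folklore] -/
theorem differentiableOn_moebius {p : ℂ} (hp : 0 < p.im) :
    DifferentiableOn ℂ (fun w ↦ (w - p) / (w - conj p)) upperHalfPlaneSet := by
  intro w hw
  have hw' : 0 < w.im := hw
  apply DifferentiableAt.differentiableWithinAt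
  exact ((differentiableAt_id.sub_const p).div (differentiableAt_id.sub_const _)
    (sub_conj_ne_zero hp hw'.le))

/-- `S_b` is holomorphic on the unit disc. [folklore] -/
theorem differentiableOn_moebiusInv (b : ℂ) :
    DifferentiableOn ℂ (fun ζ ↦ (b - conj b * ζ) / (1 - ζ)) (ball 0 1) := by
  intro ζ hζ
  have hζ1 : ζ ≠ 1 := by
    rintro rfl
    simp at hζ
  apply DifferentiableAt.differentiableWithinAt
  refine DifferentiableAt.div ?_ ?_ (sub_ne_zero.2 (Ne.symm hζ1))
  · fun_prop
  · fun_prop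

/-- The derivative of `T_p` at `p` is `1/(p - p̄)`. [folklore] -/
theorem hasDerivAt_moebius_self {p : ℂ} (hp : 0 < p.im) :
    HasDerivAt (fun w ↦ (w - p) / (w - conj p)) (1 / (p - conj p)) p := by
  have hpp : p - conj p ≠ 0 := self_sub_conj_ne_zero hp.ne'
  have h := ((hasDerivAt_id p).sub_const p).div ((hasDerivAt_id p).sub_const (conj p)) hpp
  refine h.congr_deriv ?_
  simp only [id_eq, sub_self, zero_mul, sub_zero, one_mul]
  field_simp

/-- `|p - p̄| = 2 im p` for `im p ≥ 0`. [folklore] -/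
theorem norm_self_sub_conj {p : ℂ} (hp : 0 ≤ p.im) : ‖p - conj p‖ = 2 * p.im := by
  rw [sub_conj]
  simp [abs_of_nonneg hp]

/-- **Schwarz–Pick lemma in the half-plane, two-point form**: a holomorphic self-map `F` of `ℍₒ`
contracts the pseudo-hyperbolic distance, `|T_{F b}(F a)| ≤ |T_b(a)|` (Schwarz's lemma applied to
`T_{F b} ∘ F ∘ S_b` on the unit disc). Ahlfors, *Complex Analysis*, Ch. 4 §3.4, Thm. 13 (the lemma
of Schwarz) with its invariant form (34) and Exercise 3 (the half-plane case). [folklore] -/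
theorem norm_moebius_apply_le {F : ℂ → ℂ} (hd : DifferentiableOn ℂ F upperHalfPlaneSet)
    (hmaps : MapsTo F upperHalfPlaneSet upperHalfPlaneSet) {a b : ℂ} (ha : 0 < a.im)
    (hb : 0 < b.im) :
    ‖(F a - F b) / (F a - conj (F b))‖ ≤ ‖(a - b) / (a - conj b)‖ := by
  have hFb : 0 < (F b).im := hmaps hb
  set g : ℂ → ℂ := (fun w ↦ (w - F b) / (w - conj (F b))) ∘ F ∘
    (fun ζ ↦ (b - conj b * ζ) / (1 - ζ)) with hg
  have hS : MapsTo (fun ζ ↦ (b - conj b * ζ) / (1 - ζ)) (ball 0 1) upperHalfPlaneSet :=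
    fun ζ hζ ↦ moebiusInv_im_pos hb (mem_ball_zero_iff.1 hζ)
  have hg_diff : DifferentiableOn ℂ g (ball 0 1) :=
    ((differentiableOn_moebius hFb).comp hd hmaps).comp (differentiableOn_moebiusInv b) hS
  have hg_maps : MapsTo g (ball 0 1) (closedBall 0 1) := by
    intro ζ hζ
    rw [mem_closedBall_zero_iff]
    exact (norm_moebius_lt_one hFb (hmaps (hS hζ))).le
  have hg0 : g 0 = 0 := by simp [hg]
  have key := Complex.norm_le_norm_of_mapsTo_ball hg_diff hg_maps hg0 (norm_moebius_lt_one hb ha)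
  simpa [hg, moebiusInv_moebius hb.ne' (sub_conj_ne_zero hb ha.le)] using key

/-- **Schwarz–Pick lemma in the half-plane, invariant form**: for a holomorphic self-map `F` of
`ℍₒ` and `a, b ∈ ℍₒ`, `|F a - F b|² / (im F a · im F b) ≤ |a - b|² / (im a · im b)` (stated
multiplied out, using `|a − b̄|² = |a − b|² + 4 im a im b`). Ahlfors, *Complex Analysis*, Ch. 4
§3.4, (34) and Exercise 3. [folklore] -/
theorem norm_sub_sq_mul_le {F : ℂ → ℂ} (hd : DifferentiableOn ℂ F upperHalfPlaneSet)
    (hmaps : MapsTo F upperHalfPlaneSet upperHalfPlaneSet) {a b : ℂ} (ha : 0 < a.im)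
    (hb : 0 < b.im) :
    ‖F a - F b‖ ^ 2 * (a.im * b.im) ≤ ‖a - b‖ ^ 2 * ((F a).im * (F b).im) := by
  have h := norm_moebius_apply_le hd hmaps ha hb
  have hFa : 0 < (F a).im := hmaps ha
  have hFb : 0 < (F b).im := hmaps hb
  rw [norm_div, norm_div] at h
  have p1 : 0 < ‖F a - conj (F b)‖ := norm_pos_iff.2 (sub_conj_ne_zero hFb hFa.le)
  have p2 : 0 < ‖a - conj b‖ := norm_pos_iff.2 (sub_conj_ne_zero hb ha.le)
  rw [div_le_div_iff₀ p1 p2] at h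
  have h2 : (‖F a - F b‖ * ‖a - conj b‖) ^ 2 ≤ (‖a - b‖ * ‖F a - conj (F b)‖) ^ 2 :=
    pow_le_pow_left₀ (by positivity) h 2
  rw [mul_pow, mul_pow, norm_sub_conj_sq, norm_sub_conj_sq] at h2
  nlinarith [h2, norm_nonneg (F a - F b), norm_nonneg (a - b)]

/-- **Schwarz–Pick lemma for maps of a disc into the half-plane**: if `f` is holomorphic on
`B(c, R)` with values in `ℍₒ`, then `|f'(c)| ≤ 2 im f(c) / R` (Schwarz's lemma for
`T_{f c} ∘ f`). Ahlfors, *Complex Analysis*, Ch. 4 §3.4, Thm. 13 and Exercises 1–3. [folklore] -/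
theorem norm_deriv_le_two_mul_im_div {f : ℂ → ℂ} {c : ℂ} {R : ℝ} (hR : 0 < R)
    (hd : DifferentiableOn ℂ f (ball c R)) (hmaps : MapsTo f (ball c R) upperHalfPlaneSet) :
    ‖deriv f c‖ ≤ 2 * (f c).im / R := by
  have hfc : 0 < (f c).im := hmaps (mem_ball_self hR)
  set g : ℂ → ℂ := (fun w ↦ (w - f c) / (w - conj (f c))) ∘ f with hg
  have hg_diff : DifferentiableOn ℂ g (ball c R) := (differentiableOn_moebius hfc).comp hd hmaps
  have hgc : g c = 0 := by simp [hg]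
  have hg_maps : MapsTo g (ball c R) (closedBall (g c) 1) := by
    intro z hz
    rw [hgc, mem_closedBall_zero_iff]
    exact (norm_moebius_lt_one hfc (hmaps hz)).le
  have key := Complex.norm_deriv_le_div_of_mapsTo_ball hg_diff hg_maps hR
  have hderivf : HasDerivAt f (deriv f c) c :=
    (hd.differentiableAt (ball_mem_nhds c hR)).hasDerivAt
  have hcomp : HasDerivAt g (1 / (f c - conj (f c)) * deriv f c) c :=
    (hasDerivAt_moebius_self hfc).comp c hderivf
  rw [hcomp.deriv, norm_mul, norm_div, norm_one, norm_self_sub_conj hfc.le] at key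
  have h2 : (0 : ℝ) < 2 * (f c).im := by positivity
  have h3 : ‖deriv f c‖ = 2 * (f c).im * (1 / (2 * (f c).im) * ‖deriv f c‖) := by
    field_simp
  rw [h3]
  calc 2 * (f c).im * (1 / (2 * (f c).im) * ‖deriv f c‖) ≤ 2 * (f c).im * (1 / R) :=
        mul_le_mul_of_nonneg_left key h2.le
    _ = 2 * (f c).im / R := by ring

end HalfPlanePick


/-! ### `im Φ(z) ≤ im z` for restriction maps (Julia's lemma at `∞`) -/

section Julia

variable {A : Set ℂ} {Φ : ConformalEquiv (upperHalfPlaneSet \ A) upperHalfPlaneSet}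

/-- The points `i y`, `y → +∞`, tend to `∞` inside `ℍₒ ∖ A` when `A` is bounded. [folklore] -/
theorem tendsto_I_mul_ofReal_atTop (hA : Bornology.IsBounded A) :
    Tendsto (fun y : ℝ ↦ I * y) atTop (cocompact ℂ ⊓ 𝓟 (upperHalfPlaneSet \ A)) := by
  refine tendsto_inf.2 ⟨?_, tendsto_principal.2 ?_⟩
  · rw [← Metric.cobounded_eq_cocompact, ← tendsto_norm_atTop_iff_cobounded]
    simpa using tendsto_abs_atTop_atTop
  · obtain ⟨R, hR⟩ := hA.subset_ball 0
    filter_upwards [eventually_gt_atTop (max R 0)] with y hy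
    have hy0 : 0 < y := (le_max_right R 0).trans_lt hy
    refine ⟨?_, fun hyA ↦ ?_⟩
    · show 0 < (I * (y : ℂ)).im
      simpa using hy0
    · have h := hR hyA
      rw [mem_ball_zero_iff, norm_mul, norm_I, one_mul, norm_real, Real.norm_eq_abs,
        abs_of_pos hy0] at h
      exact absurd ((le_max_left R 0).trans_lt hy) (not_lt.2 h.le)

/-- **`im Φ(z) ≤ im z` on `ℍₒ ∖ A`** for a conformal equivalence `Φ : ℍₒ ∖ A → ℍₒ` with
`Φ(z)/z → 1` at `∞` ([LSW] §2 p. 7: "`Im g_A(z) ≤ Im z`", there by the maximum principle for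
the bounded harmonic function `Im g_A(z) − Im z`). Proof here: Julia's lemma at `∞` — the
Schwarz–Pick inequality for `Φ⁻¹ : ℍₒ → ℍₒ` at the pair `(Φ z, Φ(iy))`, divided by `y³`, tends
as `y → ∞` (using `Φ(iy)/(iy) → 1`) to `im Φ(z) ≤ im z`. [cite: LawlerSchrammWerner2003Restriction, §2 p. 7 (before (2.4))] -/
theorem IsRestrictionMap.im_le_im (hA : Bornology.IsBounded A) (hΦ : IsRestrictionMap A Φ)
    {z : ℂ} (hz : z ∈ upperHalfPlaneSet \ A) : (Φ z).im ≤ z.im := by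
  have hd : DifferentiableOn ℂ Φ.symm upperHalfPlaneSet := Φ.symm.differentiableOn_coe
  have hmaps : MapsTo Φ.symm upperHalfPlaneSet upperHalfPlaneSet :=
    fun w hw ↦ (Φ.symm_mapsTo hw).1
  have hzpos : 0 < z.im := hz.1
  set u : ℝ → ℂ := fun y ↦ Φ (I * y) / (I * y) with hu
  have hu1 : Tendsto u atTop (𝓝 1) := hΦ.2.comp (tendsto_I_mul_ofReal_atTop hA)
  have hev : ∀ᶠ y : ℝ in atTop, (I * (y : ℂ)) ∈ upperHalfPlaneSet \ A ∧ 0 < y := by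
    have h1 := (tendsto_I_mul_ofReal_atTop (A := A) hA).eventually
      (mem_inf_of_right (mem_principal_self (upperHalfPlaneSet \ A)) :
        (upperHalfPlaneSet \ A) ∈ cocompact ℂ ⊓ 𝓟 (upperHalfPlaneSet \ A))
    filter_upwards [h1, eventually_gt_atTop 0] with y hy hy0 using ⟨hy, hy0⟩
  -- the Schwarz–Pick inequality at `(Φ z, Φ (iy))`, divided by `y³`
  have hineq : ∀ᶠ y : ℝ in atTop,
      ‖z / y - I‖ ^ 2 * ((Φ z).im * (u y).re) ≤ ‖Φ z / y - I * u y‖ ^ 2 * z.im := by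
    filter_upwards [hev] with y ⟨hyΩ, hy⟩
    have hSP := HalfPlanePick.norm_sub_sq_mul_le hd hmaps (Φ.mapsTo hz) (Φ.mapsTo hyΩ)
    rw [Φ.symm_apply_apply hz, Φ.symm_apply_apply hyΩ] at hSP
    have hIy : (I * (y : ℂ)).im = y := by simp
    rw [hIy] at hSP
    have hy0 : (y : ℂ) ≠ 0 := ofReal_ne_zero.2 hy.ne'
    have hΦIy : Φ (I * y) = I * y * u y := by
      rw [hu]
      field_simp
    have him : (Φ (I * y)).im = y * (u y).re := by
      rw [hΦIy]
      simp
    have hny : ‖(y : ℂ)‖ = y := by rw [norm_real, Real.norm_eq_abs, abs_of_pos hy]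
    have h1 : ‖z - I * y‖ = y * ‖z / y - I‖ := by
      have : z - I * y = y * (z / y - I) := by
        field_simp
      rw [this, norm_mul, hny]
    have h2 : ‖Φ z - Φ (I * y)‖ = y * ‖Φ z / y - I * u y‖ := by
      have : Φ z - Φ (I * y) = y * (Φ z / y - I * u y) := by
        rw [hΦIy]
        field_simp
      rw [this, norm_mul, hny]
    rw [h1, h2, him] at hSP
    have key : y ^ 3 * (‖z / y - I‖ ^ 2 * ((Φ z).im * (u y).re)) ≤
        y ^ 3 * (‖Φ z / y - I * u y‖ ^ 2 * z.im) := by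
      convert hSP using 1 <;> ring
    exact le_of_mul_le_mul_left key (by positivity)
  -- pass to the limit `y → ∞`
  have hy_inv : Tendsto (fun y : ℝ ↦ (y : ℂ)⁻¹) atTop (𝓝 0) := by
    simpa using tendsto_inv_atTop_zero.ofReal
  have hzy : Tendsto (fun y : ℝ ↦ z / y) atTop (𝓝 0) := by
    simpa [div_eq_mul_inv] using hy_inv.const_mul z
  have hΦzy : Tendsto (fun y : ℝ ↦ Φ z / y) atTop (𝓝 0) := by
    simpa [div_eq_mul_inv] using hy_inv.const_mul (Φ z)
  have hL : Tendsto (fun y : ℝ ↦ ‖z / y - I‖ ^ 2 * ((Φ z).im * (u y).re)) atTop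
      (𝓝 (‖(0 : ℂ) - I‖ ^ 2 * ((Φ z).im * (1 : ℂ).re))) :=
    ((hzy.sub_const I).norm.pow 2).mul
      (tendsto_const_nhds.mul ((continuous_re.tendsto 1).comp hu1))
  have hR : Tendsto (fun y : ℝ ↦ ‖Φ z / y - I * u y‖ ^ 2 * z.im) atTop
      (𝓝 (‖(0 : ℂ) - I * 1‖ ^ 2 * z.im)) :=
    ((hΦzy.sub (hu1.const_mul I)).norm.pow 2).mul_const _
  have := le_of_tendsto_of_tendsto hL hR hineq
  simpa using this

end Julia


/-! ### Near the origin: Lipschitz bound and continuous boundary extension -/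

section Boundary

variable {A : Set ℂ} {Φ : ConformalEquiv (upperHalfPlaneSet \ A) upperHalfPlaneSet} {r : ℝ}

/-- `ℍₒ ∖ A` is open for closed `A`. [folklore] -/
theorem isOpen_upperHalfPlaneSet_diff (hA : IsClosed A) : IsOpen (upperHalfPlaneSet \ A) :=
  isOpen_upperHalfPlaneSet.sdiff hA

/-- The half-disc `ℍₒ ∩ B(0, r)` is open. [folklore] -/
theorem isOpen_upperHalfPlaneSet_inter_ball (r : ℝ) : IsOpen (upperHalfPlaneSet ∩ ball (0 : ℂ) r) :=
  isOpen_upperHalfPlaneSet.inter isOpen_ball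

/-- If `B(0, 2r)` misses `A`, the half-disc `ℍₒ ∩ B(0, r)` lies in `ℍₒ ∖ A`. [folklore] -/
theorem inter_ball_subset_diff (hr : Disjoint (ball (0 : ℂ) (2 * r)) A) :
    upperHalfPlaneSet ∩ ball (0 : ℂ) r ⊆ upperHalfPlaneSet \ A := by
  rintro z ⟨hz, hzr⟩
  refine ⟨hz, fun hzA ↦ hr.le_bot ⟨?_, hzA⟩⟩
  rw [mem_ball_zero_iff] at hzr ⊢
  linarith [norm_nonneg z]

/-- If `B(0, 2r)` misses `A` and `z ∈ ℍₒ ∩ B(0, r)`, the disc `B(z, im z)` lies in `ℍₒ ∖ A`.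
[folklore] -/
theorem ball_im_subset_diff (hr : Disjoint (ball (0 : ℂ) (2 * r)) A) {z : ℂ}
    (hz : z ∈ upperHalfPlaneSet ∩ ball (0 : ℂ) r) : ball z z.im ⊆ upperHalfPlaneSet \ A := by
  intro ζ hζ
  rw [mem_ball, dist_eq_norm] at hζ
  have hzr : ‖z‖ < r := mem_ball_zero_iff.1 hz.2
  have him := abs_im_le_norm (ζ - z)
  rw [sub_im] at him
  refine ⟨?_, fun hζA ↦ hr.le_bot ⟨?_, hζA⟩⟩
  · show 0 < ζ.im
    have := (abs_lt.1 (him.trans_lt hζ)).1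
    linarith
  · rw [mem_ball_zero_iff]
    have hzim : z.im ≤ ‖z‖ := (le_abs_self _).trans (abs_im_le_norm z)
    calc ‖ζ‖ = ‖(ζ - z) + z‖ := by rw [sub_add_cancel]
      _ ≤ ‖ζ - z‖ + ‖z‖ := norm_add_le _ _
      _ < z.im + r := add_lt_add hζ hzr
      _ ≤ ‖z‖ + r := by linarith
      _ < 2 * r := by linarith

/-- A real point `t`, `|t| < r`, is in the closure of the half-disc `ℍₒ ∩ B(0, r)`. [folklore] -/
theorem ofReal_mem_closure_inter_ball {t : ℝ} (ht : |t| < r) :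
    (t : ℂ) ∈ closure (upperHalfPlaneSet ∩ ball (0 : ℂ) r) := by
  have hpath : Tendsto (fun ε : ℝ ↦ (t : ℂ) + I * ε) (𝓝[>] 0) (𝓝 (t : ℂ)) := by
    have : Continuous fun ε : ℝ ↦ (t : ℂ) + I * ε := by fun_prop
    simpa using (this.tendsto 0).mono_left nhdsWithin_le_nhds
  refine mem_closure_of_tendsto hpath ?_
  have hev : ∀ᶠ ε : ℝ in 𝓝[>] 0, ε < r - |t| :=
    mem_nhdsWithin_of_mem_nhds (Iio_mem_nhds (by linarith))
  filter_upwards [hev, self_mem_nhdsWithin] with ε hε hε0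
  have hε0' : 0 < ε := hε0
  refine ⟨?_, ?_⟩
  · show 0 < ((t : ℂ) + I * ε).im
    simpa using hε0'
  · rw [mem_ball_zero_iff]
    calc ‖(t : ℂ) + I * ε‖ ≤ ‖(t : ℂ)‖ + ‖I * (ε : ℂ)‖ := norm_add_le _ _
      _ = |t| + ε := by simp [abs_of_pos hε0']
      _ < r := by linarith

/-- **`|Φ'| ≤ 2` near the origin**: for `z ∈ ℍₒ ∩ B(0, r)` with `B(0, 2r) ∩ A = ∅`, the
Schwarz–Pick bound on `B(z, im z) ⊆ ℍₒ ∖ A` and `im Φ(z) ≤ im z` give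
`|Φ'(z)| ≤ 2 im Φ(z)/im z ≤ 2`. [folklore] -/
theorem IsRestrictionMap.norm_deriv_le_two (hA : IsStarHull A) (hΦ : IsRestrictionMap A Φ)
    (hr : Disjoint (ball (0 : ℂ) (2 * r)) A) {z : ℂ} (hz : z ∈ upperHalfPlaneSet ∩ ball (0 : ℂ) r) :
    ‖deriv Φ z‖ ≤ 2 := by
  have hzim : 0 < z.im := hz.1
  have hsub := ball_im_subset_diff hr hz
  have hd : DifferentiableOn ℂ Φ (ball z z.im) := Φ.differentiableOn_coe.mono hsub
  have hmaps : MapsTo Φ (ball z z.im) upperHalfPlaneSet := fun ζ hζ ↦ Φ.mapsTo (hsub hζ)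
  have h := HalfPlanePick.norm_deriv_le_two_mul_im_div hzim hd hmaps
  have hle := hΦ.im_le_im hA.1.1 (hsub (mem_ball_self hzim))
  calc ‖deriv Φ z‖ ≤ 2 * (Φ z).im / z.im := h
    _ ≤ 2 * z.im / z.im := by gcongr
    _ = 2 := by field_simp

/-- **`Φ` is `2`-Lipschitz on the half-disc `ℍₒ ∩ B(0, r)`** (`B(0, 2r) ∩ A = ∅`), by the mean
value inequality on this convex set. [folklore] -/
theorem IsRestrictionMap.lipschitzOnWith (hA : IsStarHull A) (hΦ : IsRestrictionMap A Φ)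
    (hr : Disjoint (ball (0 : ℂ) (2 * r)) A) :
    LipschitzOnWith 2 Φ (upperHalfPlaneSet ∩ ball (0 : ℂ) r) := by
  refine Convex.lipschitzOnWith_of_nnnorm_deriv_le (𝕜 := ℂ) (fun z hz ↦ ?_) (fun z hz ↦ ?_)
    ((convex_halfSpace_im_gt 0).inter (convex_ball 0 r))
  · exact Φ.differentiableOn_coe.differentiableAt
      ((isOpen_upperHalfPlaneSet_diff hA.1.isClosed).mem_nhds (inter_ball_subset_diff hr hz))
  · have h := hΦ.norm_deriv_le_two hA hr hz
    rw [← NNReal.coe_le_coe, coe_nnnorm]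
    exact_mod_cast h

/-- **Continuous extension of `Φ` to the closed half-disc**: there is a continuous `G : ℂ → ℂ`
agreeing with `Φ` on `ℍₒ ∩ B(0, r)` (Lipschitz extension). [folklore] -/
theorem IsRestrictionMap.exists_extension (hA : IsStarHull A) (hΦ : IsRestrictionMap A Φ)
    (hr : Disjoint (ball (0 : ℂ) (2 * r)) A) :
    ∃ G : ℂ → ℂ, Continuous G ∧ EqOn Φ G (upperHalfPlaneSet ∩ ball (0 : ℂ) r) := by
  obtain ⟨G, hG, hEq⟩ := (hΦ.lipschitzOnWith hA hr).extend_finite_dimension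
  exact ⟨G, hG.continuous, hEq⟩

/-- A continuous `G` agreeing with `Φ` on `W` gives the limits of `Φ` within `W`. [folklore] -/
theorem tendsto_of_eqOn_extension {G : ℂ → ℂ} {W : Set ℂ} (hG : Continuous G) (hEq : EqOn Φ G W)
    (x : ℂ) : Tendsto Φ (𝓝[W] x) (𝓝 (G x)) :=
  ((hG.tendsto x).mono_left nhdsWithin_le_nhds).congr'
    (eventually_nhdsWithin_of_forall fun _ hz ↦ (hEq hz).symm)

/-- **The boundary values on the real segment are real**: `im G(t) = 0` for `|t| < r`, since
`0 < im Φ(z) ≤ im z → 0` as `z → t`. [folklore] -/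
theorem IsRestrictionMap.extension_ofReal_im (hA : IsStarHull A) (hΦ : IsRestrictionMap A Φ)
    (hr : Disjoint (ball (0 : ℂ) (2 * r)) A) {G : ℂ → ℂ} (hG : Continuous G)
    (hEq : EqOn Φ G (upperHalfPlaneSet ∩ ball (0 : ℂ) r)) {t : ℝ} (ht : |t| < r) :
    (G t).im = 0 := by
  set W := upperHalfPlaneSet ∩ ball (0 : ℂ) r
  haveI : (𝓝[W] (t : ℂ)).NeBot :=
    mem_closure_iff_nhdsWithin_neBot.1 (ofReal_mem_closure_inter_ball ht)
  have hT : Tendsto (fun z ↦ (Φ z).im) (𝓝[W] (t : ℂ)) (𝓝 (G t).im) :=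
    (continuous_im.tendsto _).comp (tendsto_of_eqOn_extension hG hEq _)
  have hzim : Tendsto (fun z : ℂ ↦ z.im) (𝓝[W] (t : ℂ)) (𝓝 0) := by
    simpa using (continuous_im.tendsto (t : ℂ)).mono_left nhdsWithin_le_nhds
  have hup : (G t).im ≤ 0 :=
    le_of_tendsto_of_tendsto hT hzim (eventually_nhdsWithin_of_forall fun _ hz ↦
      hΦ.im_le_im hA.1.1 (inter_ball_subset_diff hr hz))
  have hdown : 0 ≤ (G t).im :=
    ge_of_tendsto hT (eventually_nhdsWithin_of_forall fun _ hz ↦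
      le_of_lt (Φ.mapsTo (inter_ball_subset_diff hr hz)))
  linarith

/-- **`G(0) = 0`**: the boundary value of `Φ` at `0` is `0` (hypothesis `Φ_A(0) = 0`). [folklore] -/
theorem IsRestrictionMap.extension_zero (hΦ : IsRestrictionMap A Φ)
    (hr : Disjoint (ball (0 : ℂ) (2 * r)) A) (hr0 : 0 < r) {G : ℂ → ℂ} (hG : Continuous G)
    (hEq : EqOn Φ G (upperHalfPlaneSet ∩ ball (0 : ℂ) r)) : G 0 = 0 := by
  set W := upperHalfPlaneSet ∩ ball (0 : ℂ) r
  have hmem : (0 : ℂ) ∈ closure W := by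
    simpa using ofReal_mem_closure_inter_ball (r := r) (t := 0) (by simpa using hr0)
  haveI : (𝓝[W] (0 : ℂ)).NeBot := mem_closure_iff_nhdsWithin_neBot.1 hmem
  have h1 : Tendsto Φ (𝓝[W] 0) (𝓝 (G 0)) := tendsto_of_eqOn_extension hG hEq 0
  have h2 : Tendsto Φ (𝓝[W] 0) (𝓝 0) :=
    (hΦ.1 : Tendsto Φ (𝓝[upperHalfPlaneSet \ A] 0) (𝓝 0)).mono_left
      (nhdsWithin_mono _ (inter_ball_subset_diff hr))
  exact tendsto_nhds_unique h1 h2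

end Boundary


/-! ### Schwarz reflection across a real segment (via Morera's theorem) -/

namespace SchwarzReflection

open scoped Interval

/-- **Morera across the real line**: a function continuous on an open `U ⊆ ℂ` and holomorphic on
`U` off the real line is holomorphic on `U` (split each rectangle at height `0`, apply
Cauchy–Goursat `Complex.integral_boundary_rect_eq_zero_of_continuousOn_of_differentiableOn` to
the halves, conclude by Morera's theorem
`Complex.isConservativeOn_and_continuousOn_iff_isDifferentiableOn`); same argument as
`Literature.Analysis.FunctionSpaces.differentiableOn_of_continuousOn_of_differentiableOn_off_im_eq` of
`Literature.Analysis.FunctionSpaces.KMSStates` (not imported here). Conway, *Functions of One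
Complex Variable* (1973), Ch. IX Thm. 1.1. [folklore] -/
theorem differentiableOn_of_off_real {f : ℂ → ℂ} {U : Set ℂ} (hU : IsOpen U)
    (hc : ContinuousOn f U) (hd : DifferentiableOn ℂ f (U \ {z | z.im = 0})) :
    DifferentiableOn ℂ f U := by
  refine ((Complex.isConservativeOn_and_continuousOn_iff_isDifferentiableOn hU).1 ⟨?_, hc⟩)
  have key : ∀ z w : ℂ, Rectangle z w ⊆ U → (0 : ℝ) ∉ Ioo (min z.im w.im) (max z.im w.im) →
      wedgeIntegral z w f + wedgeIntegral w z f = 0 := by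
    intro z w hzw hcz
    rw [wedgeIntegral_add_wedgeIntegral_eq]
    refine integral_boundary_rect_eq_zero_of_continuousOn_of_differentiableOn f z w (hc.mono hzw)
      (hd.mono fun p hp ↦ ⟨hzw ⟨Ioo_subset_Icc_self hp.1, Ioo_subset_Icc_self hp.2⟩, fun hpc ↦ ?_⟩)
    rw [mem_setOf_eq] at hpc
    exact hcz (hpc ▸ hp.2)
  intro z w hzw
  rw [eq_neg_iff_add_eq_zero]
  by_cases hcz : (0 : ℝ) ∈ Ioo (min z.im w.im) (max z.im w.im)
  swap
  · exact key z w hzw hcz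
  have hcI : (0 : ℝ) ∈ [[z.im, w.im]] := Ioo_subset_Icc_self hcz
  have hsub1 : [[z.im, 0]] ⊆ [[z.im, w.im]] := uIcc_subset_uIcc_left hcI
  have hsub2 : [[0, w.im]] ⊆ [[z.im, w.im]] := uIcc_subset_uIcc_right hcI
  have hre1 : ((w.re : ℂ) + (0 : ℝ) * I).re = w.re := by simp
  have him1 : ((w.re : ℂ) + (0 : ℝ) * I).im = 0 := by simp
  have hre2 : ((z.re : ℂ) + (0 : ℝ) * I).re = z.re := by simp
  have him2 : ((z.re : ℂ) + (0 : ℝ) * I).im = 0 := by simp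
  have hR1 : Rectangle z (w.re + (0 : ℝ) * I) ⊆ U := by
    refine Subset.trans (fun p hp ↦ ?_) hzw
    rw [Rectangle, mem_reProdIm] at hp ⊢
    rw [hre1, him1] at hp
    exact ⟨hp.1, hsub1 hp.2⟩
  have hR2 : Rectangle (z.re + (0 : ℝ) * I) w ⊆ U := by
    refine Subset.trans (fun p hp ↦ ?_) hzw
    rw [Rectangle, mem_reProdIm] at hp ⊢
    rw [hre2, him2] at hp
    exact ⟨hp.1, hsub2 hp.2⟩
  have hc1 : (0 : ℝ) ∉ Ioo (min z.im ((w.re : ℂ) + (0 : ℝ) * I).im)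
      (max z.im ((w.re : ℂ) + (0 : ℝ) * I).im) := by
    rw [him1]
    rintro ⟨h1, h2⟩
    rw [min_lt_iff] at h1
    rw [lt_max_iff] at h2
    rcases h1 with h1 | h1 <;> rcases h2 with h2 | h2 <;> linarith
  have hc2 : (0 : ℝ) ∉ Ioo (min ((z.re : ℂ) + (0 : ℝ) * I).im w.im)
      (max ((z.re : ℂ) + (0 : ℝ) * I).im w.im) := by
    rw [him2]
    rintro ⟨h1, h2⟩
    rw [min_lt_iff] at h1
    rw [lt_max_iff] at h2
    rcases h1 with h1 | h1 <;> rcases h2 with h2 | h2 <;> linarith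
  have h1 := key z _ hR1 hc1
  have h2 := key _ w hR2 hc2
  rw [wedgeIntegral_add_wedgeIntegral_eq, hre1, him1] at h1
  rw [wedgeIntegral_add_wedgeIntegral_eq, hre2, him2] at h2
  rw [wedgeIntegral_add_wedgeIntegral_eq]
  have hvert : ∀ x ∈ [[z.re, w.re]], ∀ a b : ℝ, [[a, b]] ⊆ [[z.im, w.im]] →
      IntervalIntegrable (fun y : ℝ ↦ f (x + y * I)) MeasureTheory.volume a b := by
    intro x hx a b hab
    refine (hc.comp (Continuous.continuousOn (by fun_prop)) fun y hy ↦ hzw ?_).intervalIntegrable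
    rw [Rectangle, mem_reProdIm]
    constructor
    · simpa using hx
    · simpa using hab hy
  have hv1 : (∫ y : ℝ in z.im..w.im, f (w.re + y * I)) =
      (∫ y : ℝ in z.im..(0 : ℝ), f (w.re + y * I)) + ∫ y : ℝ in (0 : ℝ)..w.im, f (w.re + y * I) :=
    (intervalIntegral.integral_add_adjacent_intervals (hvert _ right_mem_uIcc _ _ hsub1)
      (hvert _ right_mem_uIcc _ _ hsub2)).symm
  have hv2 : (∫ y : ℝ in z.im..w.im, f (z.re + y * I)) =
      (∫ y : ℝ in z.im..(0 : ℝ), f (z.re + y * I)) + ∫ y : ℝ in (0 : ℝ)..w.im, f (z.re + y * I) :=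
    (intervalIntegral.integral_add_adjacent_intervals (hvert _ left_mem_uIcc _ _ hsub1)
      (hvert _ left_mem_uIcc _ _ hsub2)).symm
  convert congrArg₂ (· + ·) h1 h2 using 1
  · rw [hv1, hv2, smul_add, smul_add]
    abel
  · simp

/-- **Schwarz reflection principle** (form with continuous boundary values): if `G` is
continuous on `ℂ`, holomorphic on the half-disc `ℍₒ ∩ B(0, r)` and real at the real points of
`B(0, r)`, then its **Schwarz reflection** in the real axis (`G` on `im z ≥ 0`, `z ↦ conj (G z̄)`
below) is holomorphic on `B(0, r)` (continuity across the segment plus Morera,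
`differentiableOn_of_off_real`). Conway, *Functions of One Complex Variable*, Ch. IX
Thm. 1.1 (exactly this form: continuous on `G₊ ∪ G₀`, analytic on `G₊`, real on `G₀`). [folklore] -/
theorem differentiableOn_reflect {G : ℂ → ℂ} {r : ℝ} (hGc : Continuous G)
    (hGd : DifferentiableOn ℂ G (upperHalfPlaneSet ∩ ball (0 : ℂ) r))
    (hreal : ∀ t : ℝ, |t| < r → (G t).im = 0) :
    DifferentiableOn ℂ (fun z ↦ if 0 ≤ z.im then G z else conj (G (conj z))) (ball (0 : ℂ) r) := by
  have hWo : IsOpen (upperHalfPlaneSet ∩ ball (0 : ℂ) r) :=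
    isOpen_upperHalfPlaneSet.inter isOpen_ball
  refine differentiableOn_of_off_real isOpen_ball ?_ ?_
  · refine ContinuousOn.if ?_ hGc.continuousOn
      (continuous_conj.comp (hGc.comp continuous_conj)).continuousOn
    rintro a ⟨haU, ha⟩
    rw [frontier_setOf_le_im] at ha
    have ha' : a.im = 0 := ha
    have hare : a = (a.re : ℂ) := Complex.ext (by simp) (by simp [ha'])
    have habs : |a.re| < r := by
      have h := mem_ball_zero_iff.1 haU
      exact (abs_re_le_norm a).trans_lt h
    rw [hare, conj_ofReal]
    exact (conj_eq_iff_im.2 (hreal _ habs)).symm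
  · rintro z ⟨hzU, hz0⟩
    have hz0' : z.im ≠ 0 := hz0
    rcases lt_or_gt_of_ne hz0' with hneg | hpos
    · have hcz : conj z ∈ upperHalfPlaneSet ∩ ball (0 : ℂ) r := by
        refine ⟨?_, ?_⟩
        · show 0 < (conj z).im
          simpa using hneg
        · simpa [mem_ball_zero_iff, norm_conj] using hzU
      have hev : (fun z ↦ if 0 ≤ z.im then G z else conj (G (conj z))) =ᶠ[𝓝 z]
          (conj ∘ G ∘ conj) := by
        filter_upwards [(isOpen_lt continuous_im continuous_const).mem_nhds hneg] with w hw
        simp only [Function.comp_apply, if_neg (not_le.2 hw)]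
      refine (hev.differentiableAt_iff.2 ?_).differentiableWithinAt
      have hd : DifferentiableAt ℂ G (conj z) := hGd.differentiableAt (hWo.mem_nhds hcz)
      simpa using hd.conj_conj
    · have hzW : z ∈ upperHalfPlaneSet ∩ ball (0 : ℂ) r := ⟨hpos, hzU⟩
      have hev : (fun z ↦ if 0 ≤ z.im then G z else conj (G (conj z))) =ᶠ[𝓝 z] G := by
        filter_upwards [(isOpen_lt continuous_const continuous_im).mem_nhds hpos] with w hw
        simp only [if_pos hw.le]
      refine (hev.differentiableAt_iff.2 ?_).differentiableWithinAt
      exact hGd.differentiableAt (hWo.mem_nhds hzW)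

end SchwarzReflection


/-! ### Local analysis at the origin: the derivative of the reflected map is not zero -/

namespace SchwarzReflection

/-- For `n ≥ 2` and `c₀ ≠ 0` there is a direction `ω` in the upper half-plane with
`im (ωⁿ c₀) < 0` (`ω = e^{iφ/n}` for a suitable `φ ∈ {π/4, π/2, π, 3π/2}`). [folklore] -/
theorem exists_im_pow_mul_neg {n : ℕ} (hn : 2 ≤ n) {c₀ : ℂ} (hc : c₀ ≠ 0) :
    ∃ ω : ℂ, 0 < ω.im ∧ (ω ^ n * c₀).im < 0 := by
  have hn0 : (n : ℝ) ≠ 0 := by exact_mod_cast (show n ≠ 0 by omega)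
  have hn2 : (2 : ℝ) ≤ n := by exact_mod_cast hn
  -- the direction `e^{iφ/n}` and its `n`-th power
  have key : ∀ φ : ℝ, 0 < φ → φ < 2 * Real.pi →
      0 < (exp (↑(φ / n) * I)).im ∧ (exp (↑(φ / n) * I)) ^ n = exp (φ * I) := by
    intro φ h0 h1
    constructor
    · rw [exp_ofReal_mul_I_im]
      apply Real.sin_pos_of_pos_of_lt_pi (by positivity)
      rw [div_lt_iff₀ (by positivity)]
      nlinarith [Real.pi_pos]
    · rw [← Complex.exp_nat_mul]
      congr 1
      have hnC : (n : ℂ) ≠ 0 := by exact_mod_cast (show n ≠ 0 by omega)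
      push_cast
      field_simp
  have him : ∀ φ : ℝ, (exp (φ * I) * c₀).im = c₀.re * Real.sin φ + c₀.im * Real.cos φ := by
    intro φ
    rw [mul_im, exp_ofReal_mul_I_re, exp_ofReal_mul_I_im]
    ring
  have hπ := Real.pi_pos
  rcases lt_trichotomy c₀.re 0 with hre | hre | hre
  · -- `φ = π/2`: `im = re c₀ < 0`
    obtain ⟨h1, h2⟩ := key (Real.pi / 2) (by positivity) (by linarith)
    refine ⟨_, h1, ?_⟩
    rw [h2, him, Real.sin_pi_div_two, Real.cos_pi_div_two]
    simpa using hre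
  · have him0 : c₀.im ≠ 0 := fun h ↦ hc (Complex.ext hre h)
    rcases lt_or_gt_of_ne him0 with hlt | hgt
    · -- `φ = π/4`: `im = im c₀ · cos (π/4) < 0`
      obtain ⟨h1, h2⟩ := key (Real.pi / 4) (by positivity) (by linarith)
      refine ⟨_, h1, ?_⟩
      rw [h2, him, hre, zero_mul, zero_add]
      exact mul_neg_of_neg_of_pos hlt (Real.cos_pos_of_mem_Ioo ⟨by linarith, by linarith⟩)
    · -- `φ = π`: `im = -im c₀ < 0`
      obtain ⟨h1, h2⟩ := key Real.pi hπ (by linarith)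
      refine ⟨_, h1, ?_⟩
      rw [h2, him, Real.sin_pi, Real.cos_pi]
      linarith
  · -- `φ = 3π/2`: `im = -re c₀ < 0`
    obtain ⟨h1, h2⟩ := key (Real.pi / 2 + Real.pi) (by positivity) (by linarith)
    refine ⟨_, h1, ?_⟩
    rw [h2, him, Real.sin_add_pi, Real.cos_add_pi, Real.sin_pi_div_two, Real.cos_pi_div_two]
    linarith

/-- **Non-vanishing of the derivative at a real boundary point**: if `F` is holomorphic on
`B(0, r)`, `F(0) = 0`, and `F` has positive imaginary part on the upper half-disc, then
`F'(0) ≠ 0`. Otherwise `F(z) = zⁿ g(z)` near `0` with `n ≥ 2`, `g(0) ≠ 0` (isolated zeros), and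
along a direction `ω ∈ ℍₒ` with `im (ωⁿ g(0)) < 0` the values `F(tω)`, `t ↓ 0`, would have
negative imaginary part. [folklore] -/
theorem deriv_ne_zero_of_im_pos {F : ℂ → ℂ} {r : ℝ} (hr : 0 < r)
    (hF : DifferentiableOn ℂ F (ball (0 : ℂ) r)) (hF0 : F 0 = 0)
    (hpos : ∀ z ∈ upperHalfPlaneSet ∩ ball (0 : ℂ) r, 0 < (F z).im) : deriv F 0 ≠ 0 := by
  intro hc
  have han : AnalyticAt ℂ F 0 := hF.analyticAt (ball_mem_nhds 0 hr)
  -- paths `t ↦ t ω` into the half-disc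
  have hpath : ∀ ω : ℂ, 0 < ω.im → Tendsto (fun t : ℝ ↦ (t : ℂ) * ω) (𝓝[>] 0) (𝓝 0) ∧
      ∀ᶠ t : ℝ in 𝓝[>] 0, (t : ℂ) * ω ∈ upperHalfPlaneSet ∩ ball (0 : ℂ) r := by
    intro ω hω
    have h1 : Tendsto (fun t : ℝ ↦ (t : ℂ) * ω) (𝓝[>] 0) (𝓝 0) := by
      have : Continuous fun t : ℝ ↦ (t : ℂ) * ω := by fun_prop
      simpa using (this.tendsto 0).mono_left nhdsWithin_le_nhds
    refine ⟨h1, ?_⟩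
    filter_upwards [h1.eventually (ball_mem_nhds (0 : ℂ) hr), self_mem_nhdsWithin] with t ht ht0
    refine ⟨?_, ht⟩
    show 0 < ((t : ℂ) * ω).im
    have ht0' : 0 < t := ht0
    simpa using mul_pos ht0' hω
  -- `F` is not identically zero near `0`
  have hne : ¬∀ᶠ z in 𝓝 (0 : ℂ), F z = 0 := by
    intro h
    obtain ⟨h1, h2⟩ := hpath I (by simp)
    obtain ⟨t, ht1, ht2⟩ := ((h1.eventually h).and h2).exists
    exact (hpos _ ht2).ne' (by rw [ht1, zero_im])
  obtain ⟨n, g, hg, hg0, hFg⟩ := han.exists_eventuallyEq_pow_smul_nonzero_iff.2 hne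
  simp only [sub_zero, smul_eq_mul] at hFg
  have hn0 : n ≠ 0 := by
    rintro rfl
    have h := hFg.self_of_nhds
    rw [hF0, pow_zero, one_mul] at h
    exact hg0 h.symm
  have hn1 : n ≠ 1 := by
    rintro rfl
    have hg' : HasDerivAt (fun z ↦ z ^ 1 * g z) (g 0) 0 := by
      have h := (hasDerivAt_id' (0 : ℂ)).fun_mul hg.differentiableAt.hasDerivAt
      simp only [one_mul, zero_mul, add_zero] at h
      simpa only [pow_one] using h
    have hF' : HasDerivAt F (g 0) 0 := hg'.congr_of_eventuallyEq hFg
    exact hg0 (by rw [← hF'.deriv, hc])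
  have hn2 : 2 ≤ n := by omega
  obtain ⟨ω, hωim, hωneg⟩ := exists_im_pow_mul_neg hn2 hg0
  obtain ⟨h1, h2⟩ := hpath ω hωim
  have hgt : Tendsto (fun t : ℝ ↦ ω ^ n * g (t * ω)) (𝓝[>] 0) (𝓝 (ω ^ n * g 0)) :=
    ((hg.continuousAt.tendsto).comp h1).const_mul _
  have hev_neg : ∀ᶠ t : ℝ in 𝓝[>] 0, (ω ^ n * g (t * ω)).im < 0 :=
    ((continuous_im.tendsto _).comp hgt).eventually (Iio_mem_nhds hωneg)
  have hev_eq : ∀ᶠ t : ℝ in 𝓝[>] 0, F (t * ω) = (t * ω) ^ n * g (t * ω) := h1.eventually hFg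
  obtain ⟨t, ht1, ht2, ht3, ht0⟩ := (hev_neg.and (hev_eq.and (h2.and self_mem_nhdsWithin))).exists
  have ht0' : 0 < t := ht0
  have hFpos := hpos _ ht3
  rw [ht2, mul_pow, mul_assoc, ← ofReal_pow, im_ofReal_mul] at hFpos
  have : (t : ℝ) ^ n * (ω ^ n * g (t * ω)).im < 0 := mul_neg_of_pos_of_neg (pow_pos ht0' n) ht1
  linarith

end SchwarzReflection


/-! ### [LSW] (2.4): `Φ'_A(0)` exists and lies in `(0, 1]` -/

/-- **[LSW] (2.4), proved**: for a `*`-hull `A` and a restriction map `Φ` of `A` (`Φ : ℍₒ ∖ A → ℍₒ`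
conformal, `Φ(0) = 0`, `Φ(z)/z → 1` at `∞`), the limit `Φ'_A(0) = lim_{z → 0} Φ(z)/z` within
`ℍₒ ∖ A` exists and `0 < Φ'_A(0) ≤ 1`. Lawler–Schramm–Werner (2003), §2 (2.4) p. 7:
"`Im g_A(z) ≤ Im z`. Consequently, `0 < g_A'(x) ≤ 1`, `x ∈ ℝ ∖ A`." Proof: `im Φ ≤ im z`
(`IsRestrictionMap.im_le_im`, Julia's lemma at `∞`); hence `|Φ'| ≤ 2` on a half-disc at `0`
(Schwarz–Pick), so `Φ` extends continuously and with real values to the real segment, and by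
Schwarz reflection (Morera) to a holomorphic `F` on a disc about `0` with `F(0) = 0`; then
`Φ(z)/z → F'(0)`, which is real, lies in `[0, 1]` along `z = it` (`0 < im Φ(it) ≤ t`), and is
nonzero (`SchwarzReflection.deriv_ne_zero_of_im_pos`). [cite: LawlerSchrammWerner2003Restriction, §2 (2.4) p. 7] -/
theorem IsStarHull.exists_hasRestrictionDeriv_holds : IsStarHull.exists_hasRestrictionDeriv := by
  intro A hA Φ hΦ
  -- a disc `B(0, 2r)` missing the closed set `A ∌ 0`
  obtain ⟨ρ, hρ, hρA⟩ : ∃ ρ > 0, ball (0 : ℂ) ρ ⊆ Aᶜ :=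
    Metric.mem_nhds_iff.1 (hA.1.isClosed.isOpen_compl.mem_nhds hA.2)
  set r : ℝ := ρ / 2 with hr_def
  have hr0 : 0 < r := by positivity
  have hr : Disjoint (ball (0 : ℂ) (2 * r)) A := by
    rw [show 2 * r = ρ by rw [hr_def]; ring]
    exact disjoint_left.2 fun z hz hzA ↦ hρA hz hzA
  set W := upperHalfPlaneSet ∩ ball (0 : ℂ) r with hW_def
  have hWΩ : W ⊆ upperHalfPlaneSet \ A := inter_ball_subset_diff hr
  -- continuous extension `G` and its reflection `F`
  obtain ⟨G, hG, hEq⟩ := hΦ.exists_extension hA hr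
  have hGreal : ∀ t : ℝ, |t| < r → (G t).im = 0 := fun t ht ↦
    hΦ.extension_ofReal_im hA hr hG hEq ht
  have hG0 : G 0 = 0 := hΦ.extension_zero hr hr0 hG hEq
  set F : ℂ → ℂ := fun z ↦ if 0 ≤ z.im then G z else conj (G (conj z)) with hF_def
  have hGd : DifferentiableOn ℂ G W := by
    intro z hz
    have hΦd : DifferentiableAt ℂ Φ z :=
      Φ.differentiableOn_coe.differentiableAt
        ((isOpen_upperHalfPlaneSet_diff hA.1.isClosed).mem_nhds (hWΩ hz))
    have hev : Φ =ᶠ[𝓝 z] G := by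
      filter_upwards [(isOpen_upperHalfPlaneSet_inter_ball r).mem_nhds hz] with w hw
      exact hEq hw
    exact (hev.differentiableAt_iff.1 hΦd).differentiableWithinAt
  have hF : DifferentiableOn ℂ F (ball (0 : ℂ) r) :=
    SchwarzReflection.differentiableOn_reflect hG hGd hGreal
  have hF0 : F 0 = 0 := by
    simp [hF_def, hG0]
  have hFt : ∀ t : ℝ, F t = G t := fun t ↦ by
    simp [hF_def]
  have hFW : ∀ z ∈ W, F z = Φ z := fun z hz ↦ by
    have hz' : 0 < z.im := hz.1
    rw [hF_def]
    simp only [if_pos hz'.le]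
    exact (hEq hz).symm
  -- the derivative `c = F'(0)` and the slope limit
  set c := deriv F 0 with hc_def
  have hderiv : HasDerivAt F c 0 := (hF.differentiableAt (ball_mem_nhds 0 hr0)).hasDerivAt
  have hslope : Tendsto (fun z ↦ F z / z) (𝓝[≠] 0) (𝓝 c) := by
    refine (hasDerivAt_iff_tendsto_slope.1 hderiv).congr' (Eventually.of_forall fun z ↦ ?_)
    rw [slope_def_field, hF0, sub_zero, sub_zero]
  have hΩle : 𝓝[upperHalfPlaneSet \ A] (0 : ℂ) ≤ 𝓝[≠] 0 := by
    refine nhdsWithin_mono _ fun z hz h0 ↦ ?_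
    have h0' : z = 0 := h0
    have him : 0 < z.im := hz.1
    rw [h0', zero_im] at him
    exact lt_irrefl _ him
  have hWmem : W ∈ 𝓝[upperHalfPlaneSet \ A] (0 : ℂ) :=
    mem_of_superset (inter_mem_nhdsWithin (upperHalfPlaneSet \ A) (ball_mem_nhds 0 hr0))
      fun z hz ↦ ⟨hz.1.1, hz.2⟩
  have hlim : Tendsto (fun z ↦ Φ z / z) (𝓝[upperHalfPlaneSet \ A] 0) (𝓝 c) := by
    refine (hslope.mono_left hΩle).congr' ?_
    filter_upwards [hWmem] with z hz
    rw [hFW z hz]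
  -- `c` is real: approach along the real axis, where `F = G` is real
  have hc_im : c.im = 0 := by
    have h1 : Tendsto (fun t : ℝ ↦ (t : ℂ)) (𝓝[≠] 0) (𝓝[≠] 0) :=
      tendsto_nhdsWithin_of_tendsto_nhds_of_eventually_within _
        ((continuous_ofReal.tendsto' 0 0 (by simp)).mono_left nhdsWithin_le_nhds)
        (eventually_nhdsWithin_of_forall fun t ht ↦ by simpa using ht)
    have h2 : Tendsto (fun t : ℝ ↦ (F t / t).im) (𝓝[≠] 0) (𝓝 c.im) :=
      (continuous_im.tendsto c).comp (hslope.comp h1)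
    have h3 : ∀ᶠ t : ℝ in 𝓝[≠] 0, (F t / t).im = 0 := by
      have h : ∀ᶠ t : ℝ in 𝓝 0, |t| < r := by
        have := (continuous_abs.tendsto' (0 : ℝ) 0 abs_zero).eventually (Iio_mem_nhds hr0)
        exact this
      filter_upwards [mem_nhdsWithin_of_mem_nhds h] with t ht
      rw [hFt, div_ofReal_im, hGreal t ht, zero_div]
    have h4 : Tendsto (fun t : ℝ ↦ (F t / t).im) (𝓝[≠] 0) (𝓝 0) :=
      tendsto_const_nhds.congr' (h3.mono fun t ht ↦ ht.symm)
    exact tendsto_nhds_unique h2 h4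
  -- `0 ≤ re c ≤ 1`: approach along the imaginary axis, where `0 < im Φ(it) ≤ t`
  have hIt : Tendsto (fun t : ℝ ↦ I * t) (𝓝[>] 0) (𝓝[upperHalfPlaneSet \ A] 0) := by
    refine tendsto_nhdsWithin_of_tendsto_nhds_of_eventually_within _ ?_ ?_
    · have : Continuous fun t : ℝ ↦ I * (t : ℂ) := by fun_prop
      simpa using (this.tendsto 0).mono_left nhdsWithin_le_nhds
    · have h : ∀ᶠ t : ℝ in 𝓝[>] 0, t < 2 * r :=
        mem_nhdsWithin_of_mem_nhds (Iio_mem_nhds (by positivity))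
      filter_upwards [h, self_mem_nhdsWithin] with t ht ht0
      have ht0' : 0 < t := ht0
      refine ⟨?_, fun htA ↦ hr.le_bot ⟨?_, htA⟩⟩
      · show 0 < (I * (t : ℂ)).im
        simpa using ht0'
      · rw [mem_ball_zero_iff]
        simpa [abs_of_pos ht0'] using ht
  have hre : Tendsto (fun t : ℝ ↦ (Φ (I * t) / (I * t)).re) (𝓝[>] 0) (𝓝 c.re) :=
    (continuous_re.tendsto c).comp (hlim.comp hIt)
  have hbounds : ∀ᶠ t : ℝ in 𝓝[>] 0, (Φ (I * t) / (I * t)).re ∈ Icc (0 : ℝ) 1 := by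
    filter_upwards [hIt.eventually_mem self_mem_nhdsWithin, self_mem_nhdsWithin] with t htΩ ht0
    have ht0' : 0 < t := ht0
    have hle : (Φ (I * t)).im ≤ t := by simpa using hΦ.im_le_im hA.1.1 htΩ
    have hposim : 0 < (Φ (I * t)).im := Φ.mapsTo htΩ
    have heq : (Φ (I * t) / (I * t)).re = (Φ (I * t)).im / t := by
      have ht' : (t : ℂ) ≠ 0 := ofReal_ne_zero.2 ht0'.ne'
      rw [div_re]
      simp [normSq_apply]
      field_simp
    rw [heq]
    exact ⟨div_nonneg hposim.le ht0'.le, (div_le_one ht0').2 hle⟩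
  have hc_mem : c.re ∈ Icc (0 : ℝ) 1 := isClosed_Icc.mem_of_tendsto hre hbounds
  -- `c ≠ 0`
  have hc_ne : c ≠ 0 :=
    SchwarzReflection.deriv_ne_zero_of_im_pos hr0 hF hF0 fun z hz ↦ by
      rw [hFW z hz]
      exact Φ.mapsTo (hWΩ hz)
  -- conclusion, with `d = re c = c`
  have hcd : ((c.re : ℝ) : ℂ) = c := Complex.ext (by simp) (by simp [hc_im])
  refine ⟨c.re, ?_, hc_mem.2, ?_⟩
  · rcases hc_mem.1.lt_or_eq with h | h
    · exact h
    · exact absurd (Complex.ext (by simpa using h.symm) (by simpa using hc_im)) hc_ne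
  · show Tendsto (fun z ↦ Φ z / z) (𝓝[upperHalfPlaneSet \ A] 0) (𝓝 ((c.re : ℝ) : ℂ))
    rw [hcd]
    exact hlim

end Literature.Probability.RandomPlanarGeometry
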